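import Summits.ABC.IUTFork.Joshi.AdelicAnsatz
import Summits.ABC.IUTFork.Joshi.ATS3FundamentalEstimate

/-!
# [J-III] Thm. 4.2.2.1 (4) ⟹ the exponent form (9.9.4): the T-07 input of the fundamental estimate's spine

Block E, seat abc-iut-E-t7, slot T-07 (cell abc-iut, rung LADDER-ABC:A2.E). TAKES NO SIDE on [IUTchIII] Cor. 3.12, on
Joshi's claims, or on Mochizuki's reports on them; typed ≠ proved. PROOF-ONLY bridge between two typed Joshi objects
(E-PLAN R14: object files may import other Joshi object files):

* `Joshi/AdelicAnsatz.lean` (this seat, p428940): `AdelicCurveDatum.ValuationScaling` = [J-III] Thm. 4.2.2.1 (4) /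
  (4.2.2.2), p.33 l.3–36, `|−|_{K′_{w,j}} = |−|^{j²}_{K′_{w,1}}` at `w ∈ V^{odd,ss}` — normalised at `j = 1`, natural
  exponent `j²`;
* `Joshi/ATS3FundamentalEstimate.lean` (seat E-t4, p428048): `ATS3.LocusDatum.ValuationScaling` = (9.9.4), p.121
  l.1–12, «by the valuation scaling property Theorem 4.2.2.1(4) one obtains
  `|log_BK(ξ_{w,j})|_{L′_{w,j}} = |q^{1/2ℓ}_{w;j}|_{L′_{w,j}} = |q^{1/2ℓ}_{w;1}|^{j²/ℓ*²}`» — normalised at the LAST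
  coordinate (`K_{w,ℓ*} = ℂ_p` at the standard point, [J-IIp] (9.2.3) p.27 l.58–60
  «`v_{K_j}(p) = j²·v_{K_1}(p) = (j²/ℓ*²)·v_{ℂ_p}(p)`»), real exponent `ATS3.LocusDatum.scalingExponent ℓ* i = (j/ℓ*)²`.

The one theorem of this file, `absK_eq_rpow_scalingExponent`, is the renormalisation from `j = 1` to `j = ℓ*`: for
`z ∈ Σ̃_{L′}`, `w ∈ V^{odd,ss}` and any element `t` of the common evaluation domain (e.g. `t = q_w^{1/2ℓ}`),
`|t|_{K′_{w,j}} = |t|_{K′_{w,ℓ*}} ^ (j/ℓ*)²` — exactly the step «(9.9.3) ⟹ (9.9.4) via Thm. 4.2.2.1 (4)» that seat E-t23's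
`LogVolumesHullsScaling` names as the T-07 input (STATUS 06:40:09Z). Elementary real arithmetic over the typed claim;
the claim itself (`ValuationScaling`) stays a HYPOTHESIS by name (derivable from the [J-2p] Thm. 6.9.1 input by
`AdelicCurveDatum.valuationScaling_of`). Positivity of the residue valuation at `t` is an explicit hypothesis (the
signature records no sign for `|−|_{K_y}`; at `t = q_w^{1/2ℓ}` it is `0 < |q_w^{1/2ℓ}|`, E-t4's `LocusDatum.qroot_pos`).
-/

noncomputable section

namespace Summit.ABC.IUTFork.Joshi

namespace AdelicCurveDatum

variable (D : AdelicCurveDatum)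

/-- Under Thm. 4.2.2.1 (4): at `w ∈ V^{odd,ss}` the `j`-th residue valuation of `z ∈ Σ̃_{L′}` is the `j²`-th power of
the first (restatement of `ValuationScaling` with the printed index made explicit: `printedIndex i = i + 1 = j`).
[claim: Joshi2024ATS3, status: disputed] -/
theorem absK_eq_pow_of_valuationScaling (hV : D.ValuationScaling) {z : D.Tuple} (hz : z ∈ D.adelicAnsatz)
    {w : D.V} (hw : w ∈ D.oddss) (i : Fin D.lstar) (t : D.T (D.pOf w)) :
    D.absK w (z i w) t = D.absK w (z D.jOne w) t ^ (((i : ℕ) + 1) ^ 2) :=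
  hV z hz w hw i t

/-- The last coordinate: `|t|_{K′_{w,ℓ*}} = |t|_{K′_{w,1}} ^ ℓ*²`. [claim: Joshi2024ATS3, status: disputed] -/
theorem absK_jLast_eq_pow_of_valuationScaling (hV : D.ValuationScaling) {z : D.Tuple} (hz : z ∈ D.adelicAnsatz)
    {w : D.V} (hw : w ∈ D.oddss) (t : D.T (D.pOf w)) :
    D.absK w (z D.jLast w) t = D.absK w (z D.jOne w) t ^ (D.lstar ^ 2) := by
  have h := hV z hz w hw D.jLast t
  rwa [D.printedIndex_jLast] at h

/-- **Thm. 4.2.2.1 (4) ⟹ (9.9.4), exponent form.** For `z ∈ Σ̃_{L′}`, `w ∈ V^{odd,ss}` and `t` in the common evaluation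
domain with `0 < |t|_{K′_{w,1}}`: `|t|_{K′_{w,j}} = |t|_{K′_{w,ℓ*}} ^ (j/ℓ*)²`, the exponent being E-t4's
`ATS3.LocusDatum.scalingExponent ℓ* i` ([J-III] p.121 l.1–12; [J-IIp] (9.2.3)). Real arithmetic:
`(a^{ℓ*²})^{(j/ℓ*)²} = a^{j²}`. [claim: Joshi2024ATS3, status: disputed] -/
theorem absK_eq_rpow_scalingExponent (hV : D.ValuationScaling) {z : D.Tuple} (hz : z ∈ D.adelicAnsatz)
    {w : D.V} (hw : w ∈ D.oddss) (t : D.T (D.pOf w)) (hpos : 0 < D.absK w (z D.jOne w) t) (i : Fin D.lstar) :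
    D.absK w (z i w) t = D.absK w (z D.jLast w) t ^ ATS3.LocusDatum.scalingExponent D.lstar i := by
  set a := D.absK w (z D.jOne w) t with ha
  have hl : (D.lstar : ℝ) ≠ 0 := by exact_mod_cast Nat.one_le_iff_ne_zero.mp D.one_le_lstar
  rw [D.absK_eq_pow_of_valuationScaling hV hz hw i t, D.absK_jLast_eq_pow_of_valuationScaling hV hz hw t, ← ha,
    ATS3.LocusDatum.scalingExponent, ← Real.rpow_natCast a (D.lstar ^ 2), ← Real.rpow_mul hpos.le,
    ← Real.rpow_natCast a]
  congr 1
  push_cast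
  field_simp

/-- **No valuation-diagonal Ansatz points at a bad place** (the Joshi-side shadow of the separation used on OUR side —
E-PLAN §2/X-02 «`(q, …, q)` is no translate of `(q, q⁴, …, q^{(ℓ*)²})`»; `Cor312PinnedCountermodel.orbitRegion_separates`): under
Thm. 4.2.2.1 (4), at `w ∈ V^{odd,ss}` the `j`-th and the first residue valuations of any `t` with `0 < |t|_{K′_{w,1}} ≠ 1` DIFFER
for every `j ≥ 2` (`a^{j²} = a` forces `a ∈ {0, 1}` for `a ≥ 0`). Elementary consequence of the typed claim; nothing asserted.
[claim: Joshi2024ATS3, status: disputed] -/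
theorem absK_ne_absK_jOne_of_valuationScaling (hV : D.ValuationScaling) {z : D.Tuple} (hz : z ∈ D.adelicAnsatz)
    {w : D.V} (hw : w ∈ D.oddss) (t : D.T (D.pOf w)) (hpos : 0 < D.absK w (z D.jOne w) t)
    (hne : D.absK w (z D.jOne w) t ≠ 1) {i : Fin D.lstar} (hi : i ≠ D.jOne) :
    D.absK w (z i w) t ≠ D.absK w (z D.jOne w) t := by
  set a := D.absK w (z D.jOne w) t with ha
  have hk : 2 ≤ ((i : ℕ) + 1) ^ 2 := by
    have : (i : ℕ) ≠ 0 := fun h => hi (Fin.ext (by simpa [AdelicCurveDatum.jOne] using h))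
    nlinarith [Nat.one_le_iff_ne_zero.mpr this]
  rw [D.absK_eq_pow_of_valuationScaling hV hz hw i t, ← ha]
  intro h
  -- `a ^ k = a` with `k ≥ 2`, `a > 0` forces `a = 1`
  have h1 : a ^ (((i : ℕ) + 1) ^ 2 - 1) = 1 := by
    have hk1 : ((i : ℕ) + 1) ^ 2 = (((i : ℕ) + 1) ^ 2 - 1) + 1 := by omega
    rw [hk1, pow_succ] at h
    -- h : a ^ (k-1) * a = a
    exact mul_left_eq_self₀.mp h |>.resolve_right hpos.ne'
  have h2 : a = 1 := by
    rcases (pow_eq_one_iff_of_nonneg hpos.le (by omega : ((i : ℕ) + 1) ^ 2 - 1 ≠ 0)).mp h1 with h2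
    exact h2
  exact hne h2

/-- In particular, under Thm. 4.2.2.1 (4) the `w`-component (`w ∈ V^{odd,ss}`) of an Ansatz point is never valuation-diagonal on
such a `t` as soon as `ℓ* ≥ 2`: the reading of the Θ-side tuple is GENUINELY scaled. [claim: Joshi2024ATS3, status: disputed] -/
theorem not_valuationDiagonal_of_valuationScaling (hV : D.ValuationScaling) (hl : 2 ≤ D.lstar) {z : D.Tuple}
    (hz : z ∈ D.adelicAnsatz) {w : D.V} (hw : w ∈ D.oddss) (t : D.T (D.pOf w)) (hpos : 0 < D.absK w (z D.jOne w) t)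
    (hne : D.absK w (z D.jOne w) t ≠ 1) :
    ¬ ∀ i : Fin D.lstar, D.absK w (z i w) t = D.absK w (z D.jOne w) t := by
  intro h
  have hi : (⟨1, hl⟩ : Fin D.lstar) ≠ D.jOne := fun h' => by
    have := congrArg Fin.val h'
    simp [AdelicCurveDatum.jOne] at this
  exact D.absK_ne_absK_jOne_of_valuationScaling hV hz hw t hpos hne hi (h ⟨1, hl⟩)

end AdelicCurveDatum

end Summit.ABC.IUTFork.Joshi

end
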